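import Mathlib
import Summits.PneNP.PneNP.Theorems.LatticeMagicBooleanSosBlindAtConstantFactorDefs
import Literature.Computability.MetaComplexity.SOSThreeColouringProofs

/-!
# PneNP / LatticeMagic — `BooleanSosBlindAtConstantFactor`, line `Sketch`: the escape-bit identity

Helper file for the lead's stub `stub_fooled` (crux stmt-PneNP-2330, Construction-A road). For a
3-clause written as `List.ofFn L` sitting at index `i` of a vector-expanding family of scope vectors
`g` with signs `b i = clauseSign`, the ESCAPE ELEMENT `h = (Σ_j φ(x_{v_j}) − rhsBit)/2` of the parity
algebra satisfies `L((h² − h)·z) = 0` for the Grigoriev–Schoenebeck moment functional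
`L = momentFunctional (pseudoMoment g b r d)` and every `z` whose monomials leave degree room `3`
(`fooledKey`): `h² − h` is a real combination of the local idempotents `eLoc L τ` of the truth patterns
`τ` with an EVEN number of true literals (`fooledKey_sq_sub`, the finite check `fooledKey_count`), and
each such idempotent is `phi (unsatPoly C')` for the sign-flipped clause `C'` with the same scope
vector and the same clause sign, which the tree's pairing lemma `momentFunctional_phi_unsatPoly_mul`
kills (`fooledKey_kill`). Sources: Grigoriev 2001 §2; Schoenebeck 2008 Thm. 4.1 / §5; the local
calculus `ThreeColGadget.eLoc` / `elem` of `SOSThreeColouringProofs.lean` (Atserias–Ochremiak 2019 §6.4).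
-/

set_option linter.dupNamespace false -- `Summit.PneNP.PneNP.…`: summit = sub-problem (D-0017)

namespace Summit.PneNP.PneNP.Theorems.ConA

open scoped BigOperators
open Finset MvPolynomial Literature.Algebra.EuclideanLattices Literature.Computability.Complexity
  Literature.Computability.MetaComplexity Literature.Computability.MetaComplexity.ThreeColGadget

noncomputable section

/-! ## Parity bookkeeping on three literals -/

/-- The finite core of the escape-bit identity: for a sign pattern `b` and a truth pattern `τ` of
three literals with an ODD number of true literals, the number `k` of variables set to `1`
(`x_{v_j} = 1 ⟺ τ j = b j`) satisfies `k − rhs ∈ {0, 2}`, where `rhs = 1` iff `∏_j (±1)_j = 1`.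
(lead's helper for stub `stub_fooled`) -/
theorem fooledKey_count (τ b : Fin 3 → Bool)
    (hodd : ¬ 2 ∣ (Finset.univ.filter fun j => τ j = true).card) :
    ((Finset.univ.filter fun j => τ j = b j).card : ℤ) -
        (if (∏ j, (if b j then (1 : ℤ) else -1)) = 1 then 1 else 0) = 0 ∨
      ((Finset.univ.filter fun j => τ j = b j).card : ℤ) -
        (if (∏ j, (if b j then (1 : ℤ) else -1)) = 1 then 1 else 0) = 2 := by
  revert τ b
  decide

/-! ## Clauses as `List.ofFn` of three literals -/

/-- The scope vector of a clause only depends on its list of variables. (lead's helper for stub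
`stub_fooled`) -/
theorem clauseVec_eq_sum_map (C : Clause ℕ) :
    clauseVec C = ((C.map Prod.fst).map fun v => (Finsupp.single v (1 : ZMod 2) : ParityVec)).sum := by
  rw [clauseVec, litVec, List.map_map, ← List.ofFn_getElem_eq_map, List.sum_ofFn]
  rfl

/-- Clauses with the same variables (in the same order) have the same scope vector. (lead's helper
for stub `stub_fooled`) -/
theorem clauseVec_eq_of_map_fst_eq {C C' : Clause ℕ} (h : C.map Prod.fst = C'.map Prod.fst) :
    clauseVec C = clauseVec C' := by
  rw [clauseVec_eq_sum_map, clauseVec_eq_sum_map, h]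

/-- The clause sign as a list product: `clauseSign C = −∏_{l ∈ C} litSign l`. (lead's helper for stub
`stub_fooled`) -/
theorem clauseSign_eq_neg_prod (C : Clause ℕ) : clauseSign C = -(C.map litSign).prod := by
  rw [clauseSign, posSign, ← List.prod_ofFn]
  congr 2
  exact List.ofFn_getElem_eq_map C litSign

/-- The literal `l` with its sign flipped iff `t`: its falsity indicator is the indicator that `l`
has truth value `t`. (lead's helper for stub `stub_fooled`) -/
theorem litInd_flip_false (l : Literal ℕ) (t : Bool) :
    litInd (l.1, if t then !l.2 else l.2) false = litInd l t := by
  rcases l with ⟨v, b⟩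
  cases t <;> cases b <;> rfl

/-- The local idempotent of the truth pattern `τ` is the arithmetised unsatisfaction polynomial of the
clause flipped along `τ`. (lead's helper for stub `stub_fooled`) -/
theorem eLoc_eq_phi_unsatPoly_flip (L : Fin 3 → Literal ℕ) (τ : Fin 3 → Bool) :
    eLoc L τ = phi (unsatPoly (List.ofFn fun j => ((L j).1, if τ j then !(L j).2 else (L j).2))) := by
  rw [phi_unsatPoly_ofFn, eLoc, eLoc]
  exact Finset.prod_congr rfl fun j _ => (litInd_flip_false (L j) (τ j)).symm

/-- Flipping along `τ` keeps the variables. (lead's helper for stub `stub_fooled`) -/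
theorem map_fst_ofFn_flip (L : Fin 3 → Literal ℕ) (τ : Fin 3 → Bool) :
    (List.ofFn fun j => ((L j).1, if τ j then !(L j).2 else (L j).2)).map Prod.fst =
      (List.ofFn L).map Prod.fst := by
  rw [List.map_ofFn, List.map_ofFn]
  rfl

/-- Flipping along a pattern with an EVEN number of true literals keeps the clause sign. (lead's
helper for stub `stub_fooled`) -/
theorem clauseSign_ofFn_flip (L : Fin 3 → Literal ℕ) (τ : Fin 3 → Bool)
    (hτ : 2 ∣ (Finset.univ.filter fun j => τ j = true).card) :
    clauseSign (List.ofFn fun j => ((L j).1, if τ j then !(L j).2 else (L j).2)) =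
      clauseSign (List.ofFn L) := by
  rw [clauseSign_eq_neg_prod, clauseSign_eq_neg_prod, List.map_ofFn, List.map_ofFn, List.prod_ofFn,
    List.prod_ofFn]
  congr 1
  have hflip : ∀ j, (litSign ∘ fun j => ((L j).1, if τ j then !(L j).2 else (L j).2)) j =
      (if τ j = true then (-1 : ℝ) else 1) * (litSign ∘ L) j := by
    intro j
    simp only [Function.comp_apply, litSign]
    cases τ j <;> cases (L j).2 <;> simp
  have hev : Even (Finset.univ.filter fun j => τ j = true).card := even_iff_two_dvd.2 hτ
  simp_rw [hflip]
  rw [Finset.prod_mul_distrib, Finset.prod_ite, Finset.prod_const_one, mul_one, Finset.prod_const,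
    hev.neg_one_pow, one_mul]

/-- **The kill.** For a pattern `τ` with an even number of true literals, the local idempotent
`eLoc L τ` of the clause `List.ofFn L` at index `i` of an expanding family (`b i` = its clause sign)
is killed by the Grigoriev–Schoenebeck functional against every `z` leaving degree room `3`.
(lead's helper for stub `stub_fooled`) -/
theorem fooledKey_kill {ι : Type*} [DecidableEq ι] {g : ι → ParityVec} {b : ι → ℝ} {r c : ℝ}
    {d : ℕ} (hexp : VecExpands g r c) (hc : 0 < c) (hd : (d : ℝ) ≤ c * r / 2) (hr : 2 ≤ r)
    (hb : ∀ i, b i * b i = 1) (L : Fin 3 → Literal ℕ) (i : ι) (hgi : g i = clauseVec (List.ofFn L))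
    (hbi : b i = clauseSign (List.ofFn L)) (τ : Fin 3 → Bool)
    (hτ : 2 ∣ (Finset.univ.filter fun j => τ j = true).card) (z : ParityAlg)
    (hz : ∀ U ∈ z.coeff.support, U.support.card + 3 ≤ d) :
    momentFunctional (pseudoMoment g b r d) (eLoc L τ * z) = 0 := by
  rw [eLoc_eq_phi_unsatPoly_flip]
  refine momentFunctional_phi_unsatPoly_mul hexp hc hd hr hb _ (by simp) i
    (hgi.trans (clauseVec_eq_of_map_fst_eq (map_fst_ofFn_flip L τ).symm))
    (hbi.trans (clauseSign_ofFn_flip L τ hτ).symm) z ?_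
  simpa using hz

/-! ## The escape element in the local calculus -/

/-- `φ(x_v)` for the variable of a literal is a literal indicator. (lead's helper for stub
`stub_fooled`) -/
theorem phiX_eq_litInd (l : Literal ℕ) : phiX l.1 = litInd l l.2 := by
  rcases l with ⟨v, _ | _⟩ <;> rfl

/-- `elem` is homogeneous. (lead's helper for stub `stub_fooled`) -/
theorem elem_const_mul {k : ℕ} (L : Fin k → Literal ℕ) (a : ℝ) (f : (Fin k → Bool) → ℝ) :
    elem L (fun τ => a * f τ) = a • elem L f := by
  unfold elem
  rw [Finset.smul_sum]
  exact Finset.sum_congr rfl fun τ _ => by rw [smul_smul]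

/-- **The square defect of the escape element.** With `k(τ) = #{j : τ j = (L j).2}` (the number of
variables of the clause set to `1` under the truth pattern `τ`) and `rb ∈ {0,1}` the XOR right-hand
side, `h = (Σ_j φ(x_{v_j}) − rb)/2 = elem L ((k − rb)/2)`, so `h² − h = Σ_τ G(τ) · eLoc L τ` with
`G(τ) = ((k−rb)/2)² − (k−rb)/2`, which VANISHES on every pattern with an odd number of true literals
(`fooledKey_count`). (lead's helper for stub `stub_fooled`) -/
theorem fooledKey_sq_sub (L : Fin 3 → Literal ℕ) (rb : ℝ)
    (hrb : rb = if (∏ j, litSignZ (L j)) = 1 then 1 else 0) (hh : ParityAlg)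
    (hdef : hh = (1 / 2 : ℝ) • ((∑ j, phiX (L j).1) - rb • (1 : ParityAlg))) :
    ∃ G : (Fin 3 → Bool) → ℝ, hh * hh - hh = ∑ τ, G τ • eLoc L τ ∧
      ∀ τ, ¬ 2 ∣ (Finset.univ.filter fun j => τ j = true).card → G τ = 0 := by
  classical
  -- the local function represented by `hh`
  set fh : (Fin 3 → Bool) → ℝ := fun τ =>
    1 / 2 * ((∑ j, if τ j = (L j).2 then (1 : ℝ) else 0) - rb) with hfh
  have hsum : (∑ j, phiX (L j).1) = elem L fun τ => ∑ j, if τ j = (L j).2 then (1 : ℝ) else 0 := by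
    have h1 : (fun τ : Fin 3 → Bool => ∑ j, if τ j = (L j).2 then (1 : ℝ) else 0) =
        ∑ j : Fin 3, (fun τ : Fin 3 → Bool => if τ j = (L j).2 then (1 : ℝ) else 0) := by
      funext τ
      simp [Finset.sum_apply]
    rw [h1, elem_finset_sum]
    exact Finset.sum_congr rfl fun j _ => by rw [phiX_eq_litInd, litInd_eq_elem]
  have hconst : rb • (1 : ParityAlg) = elem L fun _ => rb := (elem_const L rb).symm
  have hhh : hh = elem L fh := by
    rw [hdef, hsum, hconst, ← elem_sub, ← elem_const_mul]
    rfl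
  refine ⟨fun τ => fh τ * fh τ - fh τ, ?_, ?_⟩
  · rw [hhh, elem_mul_elem, ← elem_sub]
    rfl
  · intro τ hτ
    have hk : (∑ j, if τ j = (L j).2 then (1 : ℝ) else 0) =
        ((Finset.univ.filter fun j => τ j = (L j).2).card : ℤ) := by
      rw [Finset.sum_boole]
      push_cast
      rfl
    have hrb' : rb = ((if (∏ j, (if (L j).2 then (1 : ℤ) else -1)) = 1 then 1 else 0 : ℤ) : ℝ) := by
      rw [hrb]
      unfold litSignZ
      push_cast
      rfl
    show fh τ * fh τ - fh τ = 0
    rcases fooledKey_count τ (fun j => (L j).2) hτ with h0 | h2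
    · have : fh τ = 0 := by
        rw [hfh]
        simp only
        rw [hk, hrb', ← Int.cast_sub, h0]
        simp
      rw [this]; ring
    · have : fh τ = 1 := by
        rw [hfh]
        simp only
        rw [hk, hrb', ← Int.cast_sub, h2]
        norm_num
      rw [this]; ring

/-- **The escape-bit identity.** For the clause `List.ofFn L` at index `i` of a vector-expanding
family (`c > 0`, `r ≥ 2`, `d ≤ c r / 2`, signs `±1` with `b i` = the clause sign), the escape element
`h = (Σ_j φ(x_{v_j}) − rb)/2` (`rb` the XOR right-hand side) satisfies `L((h² − h) · z) = 0` for the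
Grigoriev–Schoenebeck functional `L` and every `z` all of whose monomials `y_U` have `|U| + 3 ≤ d`.
This is the only place where the pushforward of `stub_fooled` uses the parity constraints.
(lead's helper for stub `stub_fooled`) -/
theorem fooledKey {ι : Type*} [DecidableEq ι] {g : ι → ParityVec} {b : ι → ℝ} {r c : ℝ} {d : ℕ}
    (hexp : VecExpands g r c) (hc : 0 < c) (hd : (d : ℝ) ≤ c * r / 2) (hr : 2 ≤ r)
    (hb : ∀ i, b i * b i = 1) (L : Fin 3 → Literal ℕ) (i : ι) (hgi : g i = clauseVec (List.ofFn L))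
    (hbi : b i = clauseSign (List.ofFn L)) (rb : ℝ)
    (hrb : rb = if (∏ j, litSignZ (L j)) = 1 then 1 else 0) (hh : ParityAlg)
    (hdef : hh = (1 / 2 : ℝ) • ((∑ j, phiX (L j).1) - rb • (1 : ParityAlg))) (z : ParityAlg)
    (hz : ∀ U ∈ z.coeff.support, U.support.card + 3 ≤ d) :
    momentFunctional (pseudoMoment g b r d) ((hh * hh - hh) * z) = 0 := by
  classical
  obtain ⟨G, hG, hG0⟩ := fooledKey_sq_sub L rb hrb hh hdef
  rw [hG, Finset.sum_mul, map_sum]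
  refine Finset.sum_eq_zero fun τ _ => ?_
  rw [smul_mul_assoc, map_smul]
  by_cases hτ : 2 ∣ (Finset.univ.filter fun j => τ j = true).card
  · rw [fooledKey_kill hexp hc hd hr hb L i hgi hbi τ hτ z hz, smul_zero]
  · rw [hG0 τ hτ, zero_smul]

/-! ## Reading a `kClauses 3 N` clause as `List.ofFn` -/

/-- A clause of length `3` is `List.ofFn` of its three literals. (lead's helper for stub
`stub_fooled`) -/
theorem eq_ofFn_of_length {C : Clause ℕ} (h : C.length = 3) :
    C = List.ofFn fun j : Fin 3 => C[j.val]'(by rw [h]; exact j.isLt) := by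
  apply List.ext_getElem
  · rw [List.length_ofFn, h]
  · intro j h1 h2
    rw [List.getElem_ofFn]

/-- Summing over the scope of a clause on distinct variables = summing over its positions.
(lead's helper for stub `stub_fooled`) -/
theorem sum_clauseScope_ofFn {M : Type*} [AddCommMonoid M] (L : Fin 3 → Literal ℕ)
    (hnd : ((List.ofFn L).map Prod.fst).Nodup) (F : ℕ → M) :
    ∑ v ∈ clauseScope (List.ofFn L), F v = ∑ j, F (L j).1 := by
  rw [clauseScope, List.sum_toFinset _ hnd, List.map_ofFn, List.map_ofFn, List.sum_ofFn]
  rfl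

/-- The XOR right-hand side of `List.ofFn L` as a product over positions. (lead's helper for stub
`stub_fooled`) -/
theorem rhsBit_ofFn (L : Fin 3 → Literal ℕ) :
    (rhsBit (List.ofFn L) : ℝ) = if (∏ j, litSignZ (L j)) = 1 then 1 else 0 := by
  rw [rhsBit, List.map_ofFn, List.prod_ofFn]
  simp only [Function.comp_apply]
  split_ifs <;> simp

end

end Summit.PneNP.PneNP.Theorems.ConA
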